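import Summits.Ventures.PercRepro2.CaseOneRootFreeQ

/-!
# The `(i-Q)` side: the root edges at `a₃` are free MODULO the PD-odds condition (blind cell
PercRepro2, p1 g28; S5 §2.3 — the `(i-Q)` entry of the row «roots + one edge to `b`» reduced to the
candidate odds lemma (a))

The `(i)` twin of identity (E) (`iExprD_a1_edge_pull`) carries, besides `(1 − p₁) iExprD p₀` and a
`covDwIY_nonpos` term of the right sign, the term
`p₁ (1 − p₁) · (P₀(D, Y) − P₀(D, b ∈ C₁)) · [c₀ P₀(PD) − c₁ P₀(PD, o ∈ C₂)]`, whose bracket is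
nonnegative exactly under the **PD-odds condition** `c₁ · P(PD, o ∈ C₂) ≤ c₀ · P(PD)` — a condition
that is INVARIANT under the pinning of a root edge at `a₃` (the PD masses scale uniformly:
`Dpd_a1_edge`, `prob_O_PD_a1_edge`, `Dpd_a2_edge`). So, with the transported odds condition of
`CaseOneRootsAndBQ`, the predicate **`OddsAllI`** (the D-world `(i)` at every pair with `c₁ ≥ 0`
satisfying BOTH conditions) is closed under adding root edges at `a₃` (**`oddsAllI_of_a1_edge`**,
**`oddsAllI_of_a2_edge`**, **`oddsAllI_of_pinRoots`**), and holds at the bases — `a₃` isolated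
(**`oddsAllI_of_null`**), a leaf at `o` (**`oddsAllI_of_leaf_supp_o`**), a leaf at `b`
(**`oddsAllI_of_leaf_supp_b`**: `iExprD = P(D, b ∉ C₁) · (c₀ P(Q, a₃ ∈ C₁) − c₁ P(Q, a₃ ∈ C₁, o ∈ C₂))`)
— hence on the root-only, roots-and-`o`, roots-and-`b` classes. At the Q pair the first condition
is `odds_q` and the second is **`OddsPD`**: `P(Q) · P(PD, o ∈ C₂) ≤ P(Q, o ∈ U) · P(PD)`, i.e.
`P(o ∈ C₂ ∣ Q, a₃ ∉ U) ≤ P(o ∈ U ∣ Q)` — the candidate odds lemma (a) of the owner's record.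
(a) is FALSE in general: the owner's adversarial search (2026-08-28, data/p1/g28/neg-a/) found exact
violations, the simplest on 5 vertices `a₁, a₂, a₃, o, h` with the edges `a₁a₃ 99/100`, `a₁h 9/10`,
`ha₃ 9/10`, `ha₂ 99/100`, `ho 1/4`, `oa₂ 3/4`, where `q₃ = 1461/1834 > γ_Q = 240501/302983`; it holds
on the censused connected graphs with palette weights. So **`zSplitIQ_of_oddsAllI`** and the class
theorems **`zSplitIQ_of_rootsAndB_of_oddsPD`**, **`zSplitIQ_of_pinRoots_of_oddsPD`** are CONDITIONAL
on an instance-dependent hypothesis that is sometimes unavailable: `(i-Q)` of the roots-and-`b` row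
follows from (a) for the instance, and `(i-Q)` is free of the root edges at `a₃` for every `a₃` whose
instance satisfies (a) — a sufficient condition only (the route is lossy: class instances built on
the witness violate (a) while their `(i-Q)` value is positive). Nothing about `OddsPD` beyond these
implications is claimed. Own code; standard axioms.
-/

namespace Summit.Ventures.PercRepro2

namespace CaseOne

/-! ## The PD-odds condition and the predicate -/

section Defs
variable {V : Type*} {E : Type*} [Fintype E] [DecidableEq E] {R : Type*} [CommRing R] [LinearOrder R]

/-- **The candidate odds lemma (a)**: `P(Q) · P(PD, o ∈ C₂) ≤ P(Q, o ∈ U) · P(PD)`, i.e.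
`P(o ∈ C₂ ∣ Q, a₃ ∉ U) ≤ P(o ∈ U ∣ Q)`. A definition only — an instance-dependent hypothesis that is
FALSE for some instances (the 5-vertex witness of the module docstring) and true for others. -/
def OddsPD (p : E → R) (ends : E → Sym2 V) (o a₁ a₂ a₃ : V) : Prop :=
  prob p (connEvent ends a₁ a₂)ᶜ *
      prob p (connEvent ends a₂ o ∩ ((connEvent ends a₁ a₃)ᶜ ∩ (connEvent ends a₂ a₃)ᶜ ∩
        (connEvent ends a₁ a₂)ᶜ)) ≤
    Dqo p ends o a₁ a₂ * Dpd p ends a₁ a₂ a₃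

/-- **The D-world `(i)` at every pair with `c₁ ≥ 0` satisfying the odds condition
`c₁ · P(Q, a₃ ∈ C₁, o ∈ C₂) ≤ c₀ · P(Q, a₃ ∈ C₁)` and the PD-odds condition
`c₁ · P(PD, o ∈ C₂) ≤ c₀ · P(PD)`.** A definition only. -/
def OddsAllI (p : E → R) (ends : E → Sym2 V) (o a₁ a₂ a₃ b : V) : Prop :=
  ∀ c₀ c₁ : R, 0 ≤ c₁ →
    c₁ * prob p (connEvent ends a₁ a₃ ∩ connEvent ends a₂ o ∩ (connEvent ends a₁ a₂)ᶜ) ≤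
      c₀ * prob p (connEvent ends a₁ a₃ ∩ (connEvent ends a₁ a₂)ᶜ) →
    c₁ * prob p (connEvent ends a₂ o ∩ ((connEvent ends a₁ a₃)ᶜ ∩ (connEvent ends a₂ a₃)ᶜ ∩
        (connEvent ends a₁ a₂)ᶜ)) ≤
      c₀ * Dpd p ends a₁ a₂ a₃ →
    0 ≤ iExprD p ends o a₁ a₂ a₃ b c₀ c₁

end Defs

section Basic
variable {V : Type*} {E : Type*} [Fintype E] [DecidableEq E] [Fintype V] [DecidableEq V]
  {R : Type*} [Field R] [LinearOrder R] [IsStrictOrderedRing R]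
variable {ends : E → Sym2 V} {o a₁ a₂ a₃ b : V}

/-- **`OddsAllI ∧ OddsPD ⟹ (i-Q)`**: at the Q pair the odds condition is `odds_q`. -/
theorem zSplitIQ_of_oddsAllI (p : E → R) (hp : IsProbVec p) (h : OddsAllI p ends o a₁ a₂ a₃ b)
    (ha : OddsPD p ends o a₁ a₂ a₃) : ZSplitIQ p ends o a₁ a₂ a₃ b := by
  unfold ZSplitIQ
  exact iExprT_nonneg_of_dworld p hp ends o a₁ a₂ a₃ b _ _
    (h _ _ (prob_nonneg hp _) (odds_q p hp ends o a₁ a₂ a₃) ha) (odds_q p hp ends o a₁ a₂ a₃)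

omit [Fintype V] [DecidableEq V] [LinearOrder R] [IsStrictOrderedRing R] in
/-- **The `PD ∩ {o ∈ C₂}` mass under the pinning of an `a₁a₃`-edge** scales by `1 − p₁`. -/
theorem prob_O_PD_a1_edge (p : E → R) {e₁ : E} (he : ends e₁ = s(a₁, a₃)) (o : V) :
    prob p (connEvent ends a₂ o ∩ ((connEvent ends a₁ a₃)ᶜ ∩ (connEvent ends a₂ a₃)ᶜ ∩
        (connEvent ends a₁ a₂)ᶜ)) =
      (1 - p e₁) * prob (Function.update p e₁ 0) (connEvent ends a₂ o ∩
        ((connEvent ends a₁ a₃)ᶜ ∩ (connEvent ends a₂ a₃)ᶜ ∩ (connEvent ends a₁ a₂)ᶜ)) := by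
  rw [prob_eq_expect_indicator, expect_eq_update_pin p _ e₁, prob_eq_expect_indicator,
    expect_update_zero]
  have h1 : expect p (fun ω => (connEvent ends a₂ o ∩ ((connEvent ends a₁ a₃)ᶜ ∩
      (connEvent ends a₂ a₃)ᶜ ∩ (connEvent ends a₁ a₂)ᶜ)).indicator (1 : Config E → R)
      (Function.update ω e₁ true)) = 0 := by
    unfold expect
    refine Finset.sum_eq_zero fun ω _ => ?_
    dsimp only
    rw [Set.indicator_of_notMem]
    · ring
    · intro h
      have := update_false_of_mem_PD he h.2
      simp at this
  rw [h1]
  ring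

/-- **`OddsAllI` lifts along an `a₁a₃`-edge** (identity (E) for `(i)`, `covDwIY_nonpos`, the
transported odds condition and the invariant PD-odds condition). -/
theorem oddsAllI_of_a1_edge (p : E → R) (hp : IsProbVec p) {e₁ : E} (he : ends e₁ = s(a₁, a₃))
    (h : OddsAllI (Function.update p e₁ 0) ends o a₁ a₂ a₃ b) : OddsAllI p ends o a₁ a₂ a₃ b := by
  intro c₀ c₁ hc₁ hodds hpd
  rw [iExprD_a1_edge_pull p he o b c₀ c₁]
  set p₀ := Function.update p e₁ 0 with hp₀
  have hp0 : IsProbVec p₀ := hp.update e₁ le_rfl zero_le_one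
  have hcov := covDwIY_nonpos p₀ hp0 ends o a₁ a₂ a₃ b
  have h1 : 0 ≤ p e₁ := hp.nonneg e₁
  have h2 : 0 ≤ 1 - p e₁ := by linarith [hp.le_one e₁]
  have hY : prob p₀ (connEvent ends a₁ b ∩ Dw ends a₁ a₂ a₃) ≤
      prob p₀ ((connEvent ends a₁ b ∪ connEvent ends a₃ b) ∩ Dw ends a₁ a₂ a₃) :=
    prob_mono hp0 (Set.inter_subset_inter_left _ Set.subset_union_left)
  -- `P₀(D) − P₀(D, a₃ ∈ C₁) = P₀(PD)` and `P₀(D, o ∈ C₂) − P₀(D, a₃ ∈ C₁, o ∈ C₂) = P₀(PD, o ∈ C₂)`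
  have hdA : prob p₀ (Dw ends a₁ a₂ a₃) - prob p₀ (connEvent ends a₁ a₃ ∩ Dw ends a₁ a₂ a₃) =
      Dpd p₀ ends a₁ a₂ a₃ := by
    have := prob_inter_add_prob_inter_compl p₀ (Dw ends a₁ a₂ a₃) (connEvent ends a₁ a₃)
    rw [Set.inter_comm, Dw_inter_compl_A] at this
    unfold Dpd
    linarith
  have hOA : prob p₀ (connEvent ends a₂ o ∩ Dw ends a₁ a₂ a₃) -
      prob p₀ (connEvent ends a₂ o ∩ connEvent ends a₁ a₃ ∩ Dw ends a₁ a₂ a₃) =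
      prob p₀ (connEvent ends a₂ o ∩ ((connEvent ends a₁ a₃)ᶜ ∩ (connEvent ends a₂ a₃)ᶜ ∩
        (connEvent ends a₁ a₂)ᶜ)) := by
    have := prob_inter_add_prob_inter_compl p₀ (connEvent ends a₂ o ∩ Dw ends a₁ a₂ a₃)
      (connEvent ends a₁ a₃)
    have e1 : connEvent ends a₂ o ∩ Dw ends a₁ a₂ a₃ ∩ connEvent ends a₁ a₃ =
        connEvent ends a₂ o ∩ connEvent ends a₁ a₃ ∩ Dw ends a₁ a₂ a₃ := by
      ext ω; simp only [Set.mem_inter_iff]; tauto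
    have e2 : connEvent ends a₂ o ∩ Dw ends a₁ a₂ a₃ ∩ (connEvent ends a₁ a₃)ᶜ =
        connEvent ends a₂ o ∩ ((connEvent ends a₁ a₃)ᶜ ∩ (connEvent ends a₂ a₃)ᶜ ∩
          (connEvent ends a₁ a₂)ᶜ) := by
      rw [Set.inter_assoc, Dw_inter_compl_A]
    rw [e1, e2] at this
    linarith
  rw [hdA, hOA]
  have t1 := mul_nonneg (mul_nonneg h1 hc₁) (sub_nonneg.2 hcov)
  rcases (hp.le_one e₁).lt_or_eq with hlt | heq
  · -- the two conditions at `p₀`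
    have hodds0 := odds_of_a1_edge p hp he o c₀ c₁ hc₁ hodds
    have hpd0 : c₁ * prob p₀ (connEvent ends a₂ o ∩ ((connEvent ends a₁ a₃)ᶜ ∩
        (connEvent ends a₂ a₃)ᶜ ∩ (connEvent ends a₁ a₂)ᶜ)) ≤ c₀ * Dpd p₀ ends a₁ a₂ a₃ := by
      rw [Dpd_a1_edge p he, prob_O_PD_a1_edge p he o] at hpd
      have hpos : 0 < 1 - p e₁ := sub_pos.2 hlt
      have h' : (1 - p e₁) * (c₁ * prob p₀ (connEvent ends a₂ o ∩ ((connEvent ends a₁ a₃)ᶜ ∩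
          (connEvent ends a₂ a₃)ᶜ ∩ (connEvent ends a₁ a₂)ᶜ))) ≤
          (1 - p e₁) * (c₀ * Dpd p₀ ends a₁ a₂ a₃) := by linarith [hpd]
      exact le_of_mul_le_mul_left h' hpos
    have hrec := h c₀ c₁ hc₁ hodds0 hpd0
    have t2 := mul_nonneg h2 hrec
    have t3 := mul_nonneg (mul_nonneg (mul_nonneg h1 h2) (sub_nonneg.2 hY)) (sub_nonneg.2 hpd0)
    linarith [t1, t2, t3]
  · have h0 : 1 - p e₁ = 0 := by rw [← heq]; ring
    have t2 : (1 - p e₁) * iExprD p₀ ends o a₁ a₂ a₃ b c₀ c₁ = 0 := by rw [h0]; ring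
    have t3 : p e₁ * (1 - p e₁) * (prob p₀ ((connEvent ends a₁ b ∪ connEvent ends a₃ b) ∩
        Dw ends a₁ a₂ a₃) - prob p₀ (connEvent ends a₁ b ∩ Dw ends a₁ a₂ a₃)) *
        (c₀ * Dpd p₀ ends a₁ a₂ a₃ - c₁ * prob p₀ (connEvent ends a₂ o ∩
          ((connEvent ends a₁ a₃)ᶜ ∩ (connEvent ends a₂ a₃)ᶜ ∩ (connEvent ends a₁ a₂)ᶜ))) = 0 := by
      rw [h0]; ring
    linarith [t1, t2, t3]

omit [Fintype V] [DecidableEq V] in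
/-- **`OddsAllI` lifts along an `a₂a₃`-edge** (identity (E′) for `(i)`; both conditions scale). -/
theorem oddsAllI_of_a2_edge (p : E → R) (hp : IsProbVec p) {e₂ : E} (he : ends e₂ = s(a₂, a₃))
    (h : OddsAllI (Function.update p e₂ 0) ends o a₁ a₂ a₃ b) : OddsAllI p ends o a₁ a₂ a₃ b := by
  intro c₀ c₁ hc₁ hodds hpd
  rw [iExprD_a2_edge p he o b c₀ c₁]
  have hpe' : 0 ≤ 1 - p e₂ := sub_nonneg.2 (hp.le_one e₂)
  rcases (hp.le_one e₂).lt_or_eq with hlt | heq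
  · have hpos : 0 < 1 - p e₂ := sub_pos.2 hlt
    have hpd0 : c₁ * prob (Function.update p e₂ 0) (connEvent ends a₂ o ∩
        ((connEvent ends a₁ a₃)ᶜ ∩ (connEvent ends a₂ a₃)ᶜ ∩ (connEvent ends a₁ a₂)ᶜ)) ≤
        c₀ * Dpd (Function.update p e₂ 0) ends a₁ a₂ a₃ := by
      rw [Dpd_a2_edge p he, prob_a2_edge_of_subset_Dw p he (Y := connEvent ends a₂ o ∩
        ((connEvent ends a₁ a₃)ᶜ ∩ (connEvent ends a₂ a₃)ᶜ ∩ (connEvent ends a₁ a₂)ᶜ))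
        (fun _ h => ⟨h.2.2, h.2.1.2⟩)] at hpd
      have h' : (1 - p e₂) * (c₁ * prob (Function.update p e₂ 0) (connEvent ends a₂ o ∩
          ((connEvent ends a₁ a₃)ᶜ ∩ (connEvent ends a₂ a₃)ᶜ ∩ (connEvent ends a₁ a₂)ᶜ))) ≤
          (1 - p e₂) * (c₀ * Dpd (Function.update p e₂ 0) ends a₁ a₂ a₃) := by linarith [hpd]
      exact le_of_mul_le_mul_left h' hpos
    exact mul_nonneg (pow_nonneg hpe' 2)
      (h c₀ c₁ hc₁ (odds_of_a2_edge p he o c₀ c₁ hlt hodds) hpd0)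
  · rw [heq]
    simp

/-- **`(i-Q)` is free of the root edges at `a₃` modulo the PD-odds condition**: `OddsAllI` for `p`
follows from `OddsAllI` for `pinRoots p`. -/
theorem oddsAllI_of_pinRoots (p : E → R) (hp : IsProbVec p)
    (h : OddsAllI (pinRoots p ends a₁ a₂ a₃) ends o a₁ a₂ a₃ b) : OddsAllI p ends o a₁ a₂ a₃ b := by
  generalize hn : (Finset.univ.filter fun e' => (ends e' = s(a₁, a₃) ∨ ends e' = s(a₂, a₃)) ∧
    p e' ≠ 0).card = n
  induction n using Nat.strong_induction_on generalizing p with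
  | _ n ih =>
    by_cases h0 : (Finset.univ.filter fun e' => (ends e' = s(a₁, a₃) ∨ ends e' = s(a₂, a₃)) ∧
        p e' ≠ 0) = ∅
    · have hnull : ∀ e, ends e = s(a₁, a₃) ∨ ends e = s(a₂, a₃) → p e = 0 := by
        intro e he
        by_contra hc
        have : e ∈ (Finset.univ.filter fun e' => (ends e' = s(a₁, a₃) ∨ ends e' = s(a₂, a₃)) ∧
            p e' ≠ 0) := by simp [he, hc]
        rw [h0] at this
        exact absurd this (Finset.notMem_empty e)
      rw [pinRoots_eq_self p hnull] at h
      exact h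
    · obtain ⟨e, he⟩ := Finset.nonempty_iff_ne_empty.mpr h0
      have he' : ends e = s(a₁, a₃) ∨ ends e = s(a₂, a₃) := by
        have := he
        simp only [Finset.mem_filter, Finset.mem_univ, true_and] at this
        exact this.1
      have hlt : ((Finset.univ.filter fun e' => (ends e' = s(a₁, a₃) ∨ ends e' = s(a₂, a₃)) ∧
          p e' ≠ 0).erase e).card < n := by
        rw [← hn]; exact Finset.card_erase_lt_of_mem he
      have hp0 : IsProbVec (Function.update p e 0) := hp.update e le_rfl zero_le_one
      have h' : OddsAllI (pinRoots (Function.update p e 0) ends a₁ a₂ a₃) ends o a₁ a₂ a₃ b := by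
        rw [pinRoots_update p he']
        exact h
      have hrec := ih _ hlt (Function.update p e 0) hp0 h' (by rw [filter_liveRoot_update])
      rcases he' with h1 | h1
      · exact oddsAllI_of_a1_edge p hp h1 hrec
      · exact oddsAllI_of_a2_edge p hp h1 hrec

end Basic

/-! ## The bases -/

section Bases
variable {V : Type*} {E : Type*} [Fintype E] [DecidableEq E] [Fintype V] [DecidableEq V]
  {R : Type*} [Field R] [LinearOrder R] [IsStrictOrderedRing R]
variable {ends : E → Sym2 V} {o a₁ a₂ a₃ b : V}

omit [Fintype V] [DecidableEq V] in
/-- The `A`-masses vanish when `P(Q, a₃ ∈ C₁) = 0`, and so does `iExprD`. -/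
lemma iExprD_eq_zero_of_A (p : E → R) (hp : IsProbVec p)
    (hX : prob p (connEvent ends a₁ a₃ ∩ (connEvent ends a₁ a₂)ᶜ) = 0) (c₀ c₁ : R) :
    iExprD p ends o a₁ a₂ a₃ b c₀ c₁ = 0 := by
  rw [iExprD_eq]
  have z : ∀ X : Set (Config E), X ⊆ connEvent ends a₁ a₃ ∩ (connEvent ends a₁ a₂)ᶜ →
      prob p X = 0 := fun X hX' => le_antisymm (hX ▸ prob_mono hp hX') (prob_nonneg hp X)
  rw [z (connEvent ends a₁ b ∩ connEvent ends a₁ a₃ ∩ connEvent ends a₂ o ∩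
      (connEvent ends a₁ a₂)ᶜ) (fun _ h => ⟨h.1.1.2, h.2⟩),
    z (connEvent ends a₁ a₃ ∩ connEvent ends a₂ o ∩ (connEvent ends a₁ a₂)ᶜ)
      (fun _ h => ⟨h.1.1, h.2⟩),
    z (connEvent ends a₁ b ∩ connEvent ends a₁ a₃ ∩ (connEvent ends a₁ a₂)ᶜ)
      (fun _ h => ⟨h.1.2, h.2⟩), hX]
  ring

omit [Fintype V] [DecidableEq V] [IsStrictOrderedRing R] in
/-- **`a₃` isolated in the support**: `OddsAllI` (the D-world `(i)` vanishes: every `A`-mass is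
null). -/
theorem oddsAllI_of_null (p : E → R) (hnull : ∀ e, a₃ ∈ ends e → p e = 0) (h1 : a₁ ≠ a₃) :
    OddsAllI p ends o a₁ a₂ a₃ b := by
  intro c₀ c₁ _ _ _
  rw [iExprD_eq]
  have e1 : connEvent ends a₁ b ∩ connEvent ends a₁ a₃ ∩ connEvent ends a₂ o ∩
      (connEvent ends a₁ a₂)ᶜ = connEvent ends a₁ b ∩ connEvent ends a₁ a₃ ∩
      (connEvent ends a₂ o ∩ (connEvent ends a₁ a₂)ᶜ) := by rw [Set.inter_assoc]
  have e2 : connEvent ends a₁ a₃ ∩ connEvent ends a₂ o ∩ (connEvent ends a₁ a₂)ᶜ =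
      Set.univ ∩ connEvent ends a₁ a₃ ∩ (connEvent ends a₂ o ∩ (connEvent ends a₁ a₂)ᶜ) := by
    rw [Set.univ_inter, Set.inter_assoc]
  have e4 : connEvent ends a₁ a₃ ∩ (connEvent ends a₁ a₂)ᶜ =
      Set.univ ∩ connEvent ends a₁ a₃ ∩ (connEvent ends a₁ a₂)ᶜ := by rw [Set.univ_inter]
  rw [e1, e2, e4, prob_A_eq_zero_of_null p hnull h1, prob_A_eq_zero_of_null p hnull h1,
    prob_A_eq_zero_of_null p hnull h1, prob_A_eq_zero_of_null p hnull h1]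
  simp

/-- **`a₃` a leaf at `o` in the support**: `OddsAllI`. -/
theorem oddsAllI_of_leaf_supp_o (p : E → R) (hp : IsProbVec p) {e₀ : E}
    (hl : IsLeafSupp p ends o a₃ e₀) (h1 : a₁ ≠ a₃) : OddsAllI p ends o a₁ a₂ a₃ b := by
  intro c₀ c₁ hc₁ hodds _
  rcases (prob_nonneg hp (connEvent ends a₁ a₃ ∩ (connEvent ends a₁ a₂)ᶜ)).lt_or_eq with hX | hX
  · have hY := prob_nonneg hp (connEvent ends a₁ a₃ ∩ connEvent ends a₂ o ∩
      (connEvent ends a₁ a₂)ᶜ)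
    have hc₀ : 0 ≤ c₀ := by
      by_contra hc
      rw [not_le] at hc
      have : c₀ * prob p (connEvent ends a₁ a₃ ∩ (connEvent ends a₁ a₂)ᶜ) < 0 :=
        mul_neg_of_neg_of_pos hc hX
      linarith [mul_nonneg hc₁ hY]
    exact iExprD_nonneg_of_leaf_supp_o hp hl h1 b c₀ c₁ hc₀
  · simp [iExprD_eq_zero_of_A p hp hX.symm]

omit [Fintype E] [Fintype V] [DecidableEq V] [LinearOrder R] [IsStrictOrderedRing R] in
/-- For `a₃` a leaf at `b` in the support, on good configurations `a₃ ∈ C₁` forces `b ∈ C₁`. -/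
lemma conn_a1_b_of_good {p : E → R} {e₀ : E} (hl : IsLeafSupp p ends b a₃ e₀) (h1 : a₁ ≠ a₃)
    {ω : Config E} (hg : Good ends a₃ e₀ ω) (hA : Conn ends ω a₁ a₃) : Conn ends ω a₁ b := by
  by_cases he : ω e₀ = true
  · have hba : Conn ends ω b a₃ := conn_of_openAdj ⟨e₀, he, hl.ends_eq⟩
    exact conn_trans hA (conn_symm hba)
  · have he' : ω e₀ = false := by simpa using he
    exact absurd (eq_of_conn_good hg he' (conn_symm hA)) h1

omit [Fintype V] [DecidableEq V] [LinearOrder R] [IsStrictOrderedRing R] in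
/-- For `a₃` a leaf at `b` in the support, `P(b ∈ C₁, a₃ ∈ C₁, X) = P(a₃ ∈ C₁, X)`. -/
lemma prob_B1A_of_leaf_supp_b {p : E → R} {e₀ : E} (hl : IsLeafSupp p ends b a₃ e₀)
    (h1 : a₁ ≠ a₃) (X : Set (Config E)) :
    prob p (connEvent ends a₁ b ∩ connEvent ends a₁ a₃ ∩ X) =
      prob p (connEvent ends a₁ a₃ ∩ X) := by
  rw [prob_eq_expect_indicator, prob_eq_expect_indicator]
  refine expect_congr_supp hl _ _ fun ω hg => ?_
  by_cases hm : ω ∈ connEvent ends a₁ a₃ ∩ X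
  · have hb : ω ∈ connEvent ends a₁ b := by
      rw [mem_connEvent]
      exact conn_a1_b_of_good hl h1 hg hm.1
    have hm' : ω ∈ connEvent ends a₁ b ∩ connEvent ends a₁ a₃ ∩ X := ⟨⟨hb, hm.1⟩, hm.2⟩
    rw [Set.indicator_of_mem hm', Set.indicator_of_mem hm]
  · rw [Set.indicator_of_notMem (fun h => hm ⟨h.1.2, h.2⟩), Set.indicator_of_notMem hm]

omit [Fintype V] [DecidableEq V] in
/-- **The D-world `(i)` of a leaf at `b` in the support** is nonnegative at every pair with
`c₁ · P(Q, a₃ ∈ C₁, o ∈ C₂) ≤ c₀ · P(Q, a₃ ∈ C₁)`: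
`iExprD = P(D, b ∉ C₁) · (c₀ P(Q, a₃ ∈ C₁) − c₁ P(Q, a₃ ∈ C₁, o ∈ C₂))`. -/
theorem iExprD_nonneg_of_leaf_supp_b {p : E → R} (hp : IsProbVec p) {e₀ : E}
    (hl : IsLeafSupp p ends b a₃ e₀) (h1 : a₁ ≠ a₃) (o : V) (c₀ c₁ : R)
    (hodds : c₁ * prob p (connEvent ends a₁ a₃ ∩ connEvent ends a₂ o ∩ (connEvent ends a₁ a₂)ᶜ) ≤
      c₀ * prob p (connEvent ends a₁ a₃ ∩ (connEvent ends a₁ a₂)ᶜ)) :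
    0 ≤ iExprD p ends o a₁ a₂ a₃ b c₀ c₁ := by
  rw [iExprD_eq]
  have e1 : connEvent ends a₁ b ∩ connEvent ends a₁ a₃ ∩ connEvent ends a₂ o ∩
      (connEvent ends a₁ a₂)ᶜ = connEvent ends a₁ b ∩ connEvent ends a₁ a₃ ∩
      (connEvent ends a₂ o ∩ (connEvent ends a₁ a₂)ᶜ) := by rw [Set.inter_assoc]
  have e2 : connEvent ends a₁ a₃ ∩ connEvent ends a₂ o ∩ (connEvent ends a₁ a₂)ᶜ =
      connEvent ends a₁ a₃ ∩ (connEvent ends a₂ o ∩ (connEvent ends a₁ a₂)ᶜ) := by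
    rw [Set.inter_assoc]
  rw [e1, prob_B1A_of_leaf_supp_b hl h1, prob_B1A_of_leaf_supp_b hl h1, ← e2]
  have hBD : prob p (connEvent ends a₁ b ∩ Dw ends a₁ a₂ a₃) ≤ prob p (Dw ends a₁ a₂ a₃) :=
    prob_mono hp Set.inter_subset_right
  have := mul_nonneg (sub_nonneg.2 hBD) (sub_nonneg.2 hodds)
  linarith [this]

omit [Fintype V] [DecidableEq V] in
/-- **`a₃` a leaf at `b` in the support**: `OddsAllI`. -/
theorem oddsAllI_of_leaf_supp_b (p : E → R) (hp : IsProbVec p) {e₀ : E}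
    (hl : IsLeafSupp p ends b a₃ e₀) (h1 : a₁ ≠ a₃) : OddsAllI p ends o a₁ a₂ a₃ b :=
  fun c₀ c₁ _ hodds _ => iExprD_nonneg_of_leaf_supp_b hp hl h1 o c₀ c₁ hodds

end Bases

/-! ## The classes, and `(i-Q)` modulo (a) -/

section Classes
variable {V : Type*} {E : Type*} [Fintype E] [DecidableEq E] [Fintype V] [DecidableEq V]
  {R : Type*} [Field R] [LinearOrder R] [IsStrictOrderedRing R]
variable {ends : E → Sym2 V} {o a₁ a₂ a₃ b : V}

/-- **Root-only `a₃`** (every non-null edge at `a₃` joins a root): `OddsAllI`. -/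
theorem oddsAllI_of_rootsOnly (p : E → R) (hp : IsProbVec p)
    (hroot : ∀ e, a₃ ∈ ends e → p e ≠ 0 → ends e = s(a₁, a₃) ∨ ends e = s(a₂, a₃)) (h1 : a₁ ≠ a₃) :
    OddsAllI p ends o a₁ a₂ a₃ b := by
  refine oddsAllI_of_pinRoots p hp (oddsAllI_of_null _ (fun e he => ?_) h1)
  by_cases hr : ends e = s(a₁, a₃) ∨ ends e = s(a₂, a₃)
  · exact pinRoots_root_eq_zero p hr
  · rw [pinRoots_of_not_root p hr]
    by_contra hne
    exact hr (hroot e he hne)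

/-- **Roots-and-`o`**: `OddsAllI`. -/
theorem oddsAllI_of_rootsAndO (p : E → R) (hp : IsProbVec p) {e₀ : E} (he₀ : ends e₀ = s(o, a₃))
    (hroot : ∀ e, a₃ ∈ ends e → e ≠ e₀ → ends e = s(a₁, a₃) ∨ ends e = s(a₂, a₃)) (ho : o ≠ a₃)
    (h1 : a₁ ≠ a₃) : OddsAllI p ends o a₁ a₂ a₃ b :=
  oddsAllI_of_pinRoots p hp
    (oddsAllI_of_leaf_supp_o _ (isProbVec_pinRoots hp) (isLeafSupp_pinRoots p he₀ hroot ho) h1)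

/-- **Roots-and-`b`**: `OddsAllI`. -/
theorem oddsAllI_of_rootsAndB (p : E → R) (hp : IsProbVec p) {e₀ : E} (he₀ : ends e₀ = s(b, a₃))
    (hroot : ∀ e, a₃ ∈ ends e → e ≠ e₀ → ends e = s(a₁, a₃) ∨ ends e = s(a₂, a₃)) (hb : b ≠ a₃)
    (h1 : a₁ ≠ a₃) : OddsAllI p ends o a₁ a₂ a₃ b :=
  oddsAllI_of_pinRoots p hp
    (oddsAllI_of_leaf_supp_b _ (isProbVec_pinRoots hp) (isLeafSupp_pinRoots p he₀ hroot hb) h1)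

/-- **`(i-Q)` for the roots-and-`b` class MODULO (a)**: if the instance satisfies the PD-odds
condition `OddsPD` (a sufficient condition that fails on some instances), then `(i-Q)` holds for
`a₃` adjacent to the roots (any multiplicities) and to `b`. -/
theorem zSplitIQ_of_rootsAndB_of_oddsPD (p : E → R) (hp : IsProbVec p) {e₀ : E}
    (he₀ : ends e₀ = s(b, a₃))
    (hroot : ∀ e, a₃ ∈ ends e → e ≠ e₀ → ends e = s(a₁, a₃) ∨ ends e = s(a₂, a₃)) (hb : b ≠ a₃)
    (h1 : a₁ ≠ a₃) (ha : OddsPD p ends o a₁ a₂ a₃) : ZSplitIQ p ends o a₁ a₂ a₃ b :=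
  zSplitIQ_of_oddsAllI p hp (oddsAllI_of_rootsAndB p hp he₀ hroot hb h1) ha

/-- **`(i-Q)` is free of the root edges at `a₃` MODULO (a)**: `ZSplitIQ p` follows from `OddsAllI`
for the weight vector with every root edge at `a₃` null and `OddsPD p`. -/
theorem zSplitIQ_of_pinRoots_of_oddsPD (p : E → R) (hp : IsProbVec p)
    (h : OddsAllI (pinRoots p ends a₁ a₂ a₃) ends o a₁ a₂ a₃ b) (ha : OddsPD p ends o a₁ a₂ a₃) :
    ZSplitIQ p ends o a₁ a₂ a₃ b :=
  zSplitIQ_of_oddsAllI p hp (oddsAllI_of_pinRoots p hp h) ha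

end Classes

end CaseOne

end Summit.Ventures.PercRepro2
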